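import Summits.BirchSwinnertonDyer.BirchSwinnertonDyer.Theorems.ResidualThetaTransportAtTwoThetaLayerLambdaCongruenceAtTwoCuspSpanCharacterSums
import HarnessLib

/-!
# Route `ResidualThetaTransportAtTwo`, cruxes Kan⁺ (stmt-BirchSwinnertonDyer-20688) / node 27436 / 21437: CHARACTER SUMS, SECOND MOMENT —
# few unrealised coset pairs per row, and a good pivot for the one-step propagation when `p ≳ 3n³`

Cell `bsd-wall`, width seat `bsd-wall-rtt-p3-w5` g2 (2026-08-28). THEOREMS ONLY, pure finite-field character theory over `ℂ`;
`--supports stmt-BirchSwinnertonDyer-20688`. BSD is not proved by this. Sequel of `…CuspSpanCharacterSums` (p637902): same setting — `X` a finite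
set of `ℂ`-valued characters of `𝔽ₚ` standing for the annihilator of a subgroup `H ≤ 𝔽ₚˣ` (`#X = n`), `Bad(a, b)` := «no `h₁, h₂ ∈ H` with
`a h₁ + b h₂ = 1`», `T(a, b) := Σ_{χ,ψ∈X} χ(a⁻¹)ψ(b⁻¹)J(χ,ψ)` (`= 0` on bad pairs, p637902).

* §1 `sum_norm_sq_sum_mul_apply_inv` (Parseval over `𝔽ₚ`): `Σ_{b ∈ 𝔽ₚ} |Σ_{ψ∈Y} c_ψ ψ(b⁻¹)|² = (p − 1) Σ_{ψ∈Y} |c_ψ|²` for any finite set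
  `Y` of characters (Mathlib `MulChar.sum_eq_zero_of_ne_one`, `MulChar.sum_one_eq_card_units`).
* §2 `norm_rowSum_le` (`|Σ_{χ∈X} χ(a⁻¹)J(χ,ψ)| ≤ 2 + (n−2)√p` for `ψ ≠ 1`), `le_norm_mainRow` (`|Σ_{χ∈X} χ(a⁻¹)J(χ,1)| ≥ p − 1 − n`).
* §3 `card_bad_mul_le` (SECOND MOMENT): for a set `B` of units `b` with `Bad(a, b)`:
  `#B · (p − 1 − n)² ≤ (p − 1)(n − 1)(2 + (n−2)√p)²`.
* §4 `exists_good_pivot`: if `3(n−1)(2 + (n−2)√p)² < (p−1−n)²` then for all units `a, x` some unit `b` has `¬Bad(a, ab)`, `¬Bad(ab, ax)`,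
  `¬Bad(b, x)` — the hypothesis of the one-step propagation criterion (`…CuspSpanCosetPropagation`). This replaces the all-pairs threshold
  `p ≳ n⁴` of `exists_mem_coset_pair` by `p ≳ 3n³`.

References: K. Ireland, M. Rosen, GTM 84, Ch. 8; A. Weil, Bull. AMS 55 (1949); [Manin1972] §1.5; [Pollack2003] Conj. 6.3.
-/

set_option autoImplicit false
set_option linter.dupNamespace false

open scoped ComplexConjugate

namespace Summit.BirchSwinnertonDyer.BirchSwinnertonDyer.Theorems.SignedMuAtTwo.CharacterSums

variable {p : ℕ} [Fact p.Prime]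

/-! ## §1. Parseval over `𝔽ₚ` for a finite set of characters -/

/-- `Σ_{b ∈ 𝔽ₚ} χ(b⁻¹) = Σ_{b ∈ 𝔽ₚ} χ(b)`. [folklore] -/
theorem sum_apply_inv (χ : MulChar (ZMod p) ℂ) : ∑ b : ZMod p, χ b⁻¹ = ∑ b : ZMod p, χ b :=
  Fintype.sum_equiv (Equiv.inv (ZMod p)) _ _ fun _ ↦ rfl

/-- `Σ_{b ∈ 𝔽ₚ} (ψ ψ⁻¹)(b⁻¹) = p − 1`. [folklore] -/
theorem sum_mul_inv_self_apply_inv (ψ : MulChar (ZMod p) ℂ) :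
    ∑ b : ZMod p, (ψ * ψ⁻¹) b⁻¹ = (p : ℂ) - 1 := by
  have hp : p.Prime := Fact.out
  rw [sum_apply_inv, mul_inv_cancel, MulChar.sum_one_eq_card_units, ZMod.card_units, Nat.cast_sub hp.one_lt.le,
    Nat.cast_one]

/-- `Σ_{b ∈ 𝔽ₚ} (ψ ψ'⁻¹)(b⁻¹) = 0` for `ψ ≠ ψ'`. [folklore] -/
theorem sum_mul_inv_apply_inv_of_ne {ψ ψ' : MulChar (ZMod p) ℂ} (h : ψ ≠ ψ') :
    ∑ b : ZMod p, (ψ * ψ'⁻¹) b⁻¹ = 0 := by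
  rw [sum_apply_inv]
  exact MulChar.sum_eq_zero_of_ne_one (fun h' ↦ h (mul_inv_eq_one.mp h'))

/-- **Parseval.** For a finite set `Y` of characters and coefficients `c`: `Σ_{b ∈ 𝔽ₚ} |Σ_{ψ∈Y} c ψ · ψ(b⁻¹)|² = (p−1) Σ_{ψ∈Y} |c ψ|²`.
[folklore] -/
theorem sum_norm_sq_sum_mul_apply_inv (Y : Finset (MulChar (ZMod p) ℂ)) (c : MulChar (ZMod p) ℂ → ℂ) :
    ∑ b : ZMod p, ‖∑ ψ ∈ Y, c ψ * ψ b⁻¹‖ ^ 2 = ((p : ℝ) - 1) * ∑ ψ ∈ Y, ‖c ψ‖ ^ 2 := by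
  classical
  -- complex form of each term
  have key : ∀ b : ZMod p, ((‖∑ ψ ∈ Y, c ψ * ψ b⁻¹‖ : ℝ) : ℂ) ^ 2 =
      ∑ ψ ∈ Y, ∑ ψ' ∈ Y, c ψ * conj (c ψ') * (ψ * ψ'⁻¹) b⁻¹ := by
    intro b
    have e : ((‖∑ ψ ∈ Y, c ψ * ψ b⁻¹‖ : ℝ) : ℂ) ^ 2 =
        (∑ ψ ∈ Y, c ψ * ψ b⁻¹) * conj (∑ ψ ∈ Y, c ψ * ψ b⁻¹) := by
      rw [Complex.mul_conj, Complex.normSq_eq_norm_sq]; push_cast; ring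
    rw [e, map_sum, Finset.sum_mul_sum]
    refine Finset.sum_congr rfl fun ψ _ ↦ Finset.sum_congr rfl fun ψ' _ ↦ ?_
    rw [map_mul, MulChar.mul_apply]
    have h' : conj (ψ' b⁻¹) = ψ'⁻¹ b⁻¹ := MulChar.star_apply' ψ' _
    rw [h']; ring
  have hsq : ∀ ψ : MulChar (ZMod p) ℂ, ((‖c ψ‖ : ℝ) : ℂ) ^ 2 = c ψ * conj (c ψ) := by
    intro ψ; rw [Complex.mul_conj, Complex.normSq_eq_norm_sq]; push_cast; ring
  apply Complex.ofReal_injective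
  push_cast
  rw [Finset.sum_congr rfl fun b _ ↦ key b, Finset.sum_comm, Finset.mul_sum]
  refine Finset.sum_congr rfl fun ψ hψ ↦ ?_
  rw [Finset.sum_comm]
  -- inner sum over `ψ'`: only `ψ' = ψ` survives
  rw [Finset.sum_eq_single ψ]
  · rw [← Finset.mul_sum, sum_mul_inv_self_apply_inv, hsq]; ring
  · intro ψ' _ hne
    rw [← Finset.mul_sum, sum_mul_inv_apply_inv_of_ne (Ne.symm hne), mul_zero]
  · intro h; exact absurd hψ h

/-! ## §2. Row sums: the generic rows are small, the main row is large -/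

/-- **Generic row.** For `X ∋ 1` closed under inverses, a unit `a` and `ψ ∈ X`, `ψ ≠ 1`:
`|Σ_{χ∈X} χ(a⁻¹) J(χ, ψ)| ≤ 2 + (n − 2)√p` (`χ = 1` and `χ = ψ⁻¹` give norm-`1` terms, the others norm `√p`). [folklore] -/
theorem norm_rowSum_le (X : Finset (MulChar (ZMod p) ℂ)) (hone : 1 ∈ X) (hinv : ∀ χ ∈ X, χ⁻¹ ∈ X)
    (a : (ZMod p)ˣ) {ψ : MulChar (ZMod p) ℂ} (hψX : ψ ∈ X) (hψ1 : ψ ≠ 1) :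
    ‖∑ χ ∈ X, χ ((a⁻¹ : (ZMod p)ˣ) : ZMod p) * jacobiSum χ ψ‖ ≤ 2 + ((X.card - 2 : ℕ) : ℝ) * Real.sqrt p := by
  classical
  set X' : Finset (MulChar (ZMod p) ℂ) := X.erase 1 with hX'
  have hψinv1 : ψ⁻¹ ≠ 1 := inv_ne_one.mpr hψ1
  have hψinvX' : ψ⁻¹ ∈ X' := Finset.mem_erase.mpr ⟨hψinv1, hinv ψ hψX⟩
  have hcard : (X'.erase ψ⁻¹).card = X.card - 2 := by
    rw [Finset.card_erase_of_mem hψinvX', Finset.card_erase_of_mem hone]; omega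
  have n1 : ‖(1 : MulChar (ZMod p) ℂ) ((a⁻¹ : (ZMod p)ˣ) : ZMod p) * jacobiSum 1 ψ‖ = 1 := by
    rw [MulChar.one_apply_coe, one_mul, jacobiSum_one_nontrivial hψ1, norm_neg, norm_one]
  have n2 : ‖ψ⁻¹ ((a⁻¹ : (ZMod p)ˣ) : ZMod p) * jacobiSum ψ⁻¹ ψ‖ = 1 := by
    have hJ : jacobiSum ψ⁻¹ ψ = -ψ⁻¹ (-1) := by
      have h := jacobiSum_nontrivial_inv hψinv1
      rwa [inv_inv] at h
    have hm1 : ‖ψ⁻¹ (-1 : ZMod p)‖ = 1 := by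
      have h := norm_apply_coe_units ψ⁻¹ (-1)
      rwa [Units.val_neg, Units.val_one] at h
    rw [norm_mul, norm_apply_coe_units, hJ, norm_neg, hm1]; ring
  have n3 : ∀ χ ∈ X'.erase ψ⁻¹, ‖χ ((a⁻¹ : (ZMod p)ˣ) : ZMod p) * jacobiSum χ ψ‖ = Real.sqrt p := by
    intro χ hχ
    have hχinv : χ ≠ ψ⁻¹ := Finset.ne_of_mem_erase hχ
    have hχ1 : χ ≠ 1 := Finset.ne_of_mem_erase (Finset.mem_of_mem_erase hχ)
    have hχψ : χ * ψ ≠ 1 := fun h ↦ hχinv (eq_inv_of_mul_eq_one_left h)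
    rw [norm_mul, norm_apply_coe_units, one_mul, norm_jacobiSum_eq_sqrt hχ1 hψ1 hχψ]
  rw [← Finset.add_sum_erase X _ hone, ← Finset.add_sum_erase X' _ hψinvX']
  have i1 := norm_add_le ((1 : MulChar (ZMod p) ℂ) ((a⁻¹ : (ZMod p)ˣ) : ZMod p) * jacobiSum 1 ψ)
    (ψ⁻¹ ((a⁻¹ : (ZMod p)ˣ) : ZMod p) * jacobiSum ψ⁻¹ ψ +
      ∑ χ ∈ X'.erase ψ⁻¹, χ ((a⁻¹ : (ZMod p)ˣ) : ZMod p) * jacobiSum χ ψ)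
  have i2 := norm_add_le (ψ⁻¹ ((a⁻¹ : (ZMod p)ˣ) : ZMod p) * jacobiSum ψ⁻¹ ψ)
    (∑ χ ∈ X'.erase ψ⁻¹, χ ((a⁻¹ : (ZMod p)ˣ) : ZMod p) * jacobiSum χ ψ)
  have i3 := norm_sum_le (X'.erase ψ⁻¹) (fun χ ↦ χ ((a⁻¹ : (ZMod p)ˣ) : ZMod p) * jacobiSum χ ψ)
  rw [Finset.sum_congr rfl n3, Finset.sum_const, nsmul_eq_mul, hcard] at i3
  rw [n1] at i1
  rw [n2] at i2
  linarith

/-- **Main row.** For `X ∋ 1` and a unit `a`: `|Σ_{χ∈X} χ(a⁻¹) J(χ, 1)| ≥ p − 1 − n` (`J(1,1) = p − 2`, the other `n − 1` terms have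
norm `1`). [folklore] -/
theorem le_norm_mainRow (X : Finset (MulChar (ZMod p) ℂ)) (hone : 1 ∈ X) (a : (ZMod p)ˣ) :
    (p : ℝ) - 1 - X.card ≤ ‖∑ χ ∈ X, χ ((a⁻¹ : (ZMod p)ˣ) : ZMod p) * jacobiSum χ 1‖ := by
  classical
  have hp2 : (2 : ℝ) ≤ p := by exact_mod_cast (Fact.out : p.Prime).two_le
  set X' : Finset (MulChar (ZMod p) ℂ) := X.erase 1 with hX'
  have hcard' : (X'.card : ℝ) = (X.card : ℝ) - 1 := by
    rw [hX', Finset.card_erase_of_mem hone, Nat.cast_sub (Finset.one_le_card.mpr ⟨1, hone⟩)]; norm_num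
  have n0 : (1 : MulChar (ZMod p) ℂ) ((a⁻¹ : (ZMod p)ˣ) : ZMod p) * jacobiSum (1 : MulChar (ZMod p) ℂ) 1 = (p : ℂ) - 2 := by
    rw [MulChar.one_apply_coe, one_mul, jacobiSum_one_one, ZMod.card p]
  have n1 : ∀ χ ∈ X', ‖χ ((a⁻¹ : (ZMod p)ˣ) : ZMod p) * jacobiSum χ 1‖ = 1 := by
    intro χ hχ
    have hχ1 : χ ≠ 1 := Finset.ne_of_mem_erase hχ
    rw [norm_mul, norm_apply_coe_units, jacobiSum_comm, jacobiSum_one_nontrivial hχ1, norm_neg, norm_one]; ring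
  rw [← Finset.add_sum_erase X _ hone, n0]
  set S : ℂ := ∑ χ ∈ X', χ ((a⁻¹ : (ZMod p)ˣ) : ZMod p) * jacobiSum χ 1 with hS
  have i1 := norm_sum_le X' (fun χ ↦ χ ((a⁻¹ : (ZMod p)ˣ) : ZMod p) * jacobiSum χ 1)
  rw [Finset.sum_congr rfl n1, Finset.sum_const, nsmul_eq_mul, mul_one, hcard'] at i1
  have i2 := norm_add_le (((p : ℂ) - 2) + S) (-S)
  rw [add_neg_cancel_right, norm_neg] at i2
  have hnorm : ‖(p : ℂ) - 2‖ = (p : ℝ) - 2 := by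
    rw [show (p : ℂ) - 2 = ((p - 2 : ℝ) : ℂ) by push_cast; ring, Complex.norm_real, Real.norm_eq_abs,
      abs_of_nonneg (by linarith)]
  rw [hnorm] at i2
  change (p : ℝ) - 1 - X.card ≤ ‖((p : ℂ) - 2) + S‖
  linarith

/-! ## §3. Second moment: few bad entries in every row -/

open Classical in
/-- The double sum of a pair as «main row + oscillating part»:
`Σ_{χ,ψ∈X} χ(a⁻¹)ψ(b⁻¹)J(χ,ψ) = Σ_χ χ(a⁻¹)J(χ,1) + Σ_{ψ ∈ X∖{1}} (Σ_χ χ(a⁻¹)J(χ,ψ)) · ψ(b⁻¹)`. [folklore] -/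
theorem sum_sum_jacobiSum_eq_main_add (X : Finset (MulChar (ZMod p) ℂ)) (hone : 1 ∈ X) (a b : (ZMod p)ˣ) :
    ∑ χ ∈ X, ∑ ψ ∈ X, χ ((a⁻¹ : (ZMod p)ˣ) : ZMod p) * ψ ((b⁻¹ : (ZMod p)ˣ) : ZMod p) * jacobiSum χ ψ =
      ∑ χ ∈ X, χ ((a⁻¹ : (ZMod p)ˣ) : ZMod p) * jacobiSum χ 1 +
        ∑ ψ ∈ X.erase 1, (∑ χ ∈ X, χ ((a⁻¹ : (ZMod p)ˣ) : ZMod p) * jacobiSum χ ψ) * ψ ((b : ZMod p)⁻¹) := by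
  classical
  rw [Finset.sum_comm, ← Finset.add_sum_erase X _ hone]
  congr 1
  · refine Finset.sum_congr rfl fun χ _ ↦ ?_
    rw [MulChar.one_apply_coe]; ring
  · refine Finset.sum_congr rfl fun ψ _ ↦ ?_
    rw [Finset.sum_mul]
    refine Finset.sum_congr rfl fun χ _ ↦ ?_
    rw [Units.val_inv_eq_inv_val b]; ring

/-- **Second moment.** For `X` (the annihilator of `H`, `#X = n`, `n + 1 ≤ p`), a unit `a` and a finite set `B` of units `b` such that
no `h₁, h₂ ∈ H` have `a h₁ + b h₂ = 1`: `#B · (p − 1 − n)² ≤ (p − 1)(n − 1)(2 + (n − 2)√p)²`. [folklore] -/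
theorem card_bad_mul_le (X : Finset (MulChar (ZMod p) ℂ)) (H : Subgroup (ZMod p)ˣ) (hone : 1 ∈ X)
    (hmul : ∀ χ ∈ X, ∀ ψ ∈ X, χ * ψ ∈ X) (hinv : ∀ χ ∈ X, χ⁻¹ ∈ X)
    (hsep : ∀ m : (ZMod p)ˣ, m ∉ H → ∃ χ ∈ X, χ (m : ZMod p) ≠ 1) (hn : X.card + 1 ≤ p)
    (a : (ZMod p)ˣ) (B : Finset (ZMod p)ˣ)
    (hB : ∀ b ∈ B, ∀ h₁ ∈ H, ∀ h₂ ∈ H, ((a * h₁ : (ZMod p)ˣ) : ZMod p) + ((b * h₂ : (ZMod p)ˣ) : ZMod p) ≠ 1) :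
    (B.card : ℝ) * ((p : ℝ) - 1 - X.card) ^ 2 ≤
      ((p : ℝ) - 1) * (((X.card - 1 : ℕ) : ℝ) * (2 + ((X.card - 2 : ℕ) : ℝ) * Real.sqrt p) ^ 2) := by
  classical
  set E : ℂ := ∑ χ ∈ X, χ ((a⁻¹ : (ZMod p)ˣ) : ZMod p) * jacobiSum χ 1 with hE
  set A : MulChar (ZMod p) ℂ → ℂ := fun ψ ↦ ∑ χ ∈ X, χ ((a⁻¹ : (ZMod p)ˣ) : ZMod p) * jacobiSum χ ψ with hA
  set X' : Finset (MulChar (ZMod p) ℂ) := X.erase 1 with hX'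
  set S : ZMod p → ℂ := fun c ↦ ∑ ψ ∈ X', A ψ * ψ c⁻¹ with hS
  have hcard' : X'.card = X.card - 1 := Finset.card_erase_of_mem hone
  -- for a bad `b`: `E + S b = 0`, so `‖S b‖ = ‖E‖`
  have hbad : ∀ b ∈ B, ‖S (b : ZMod p)‖ = ‖E‖ := by
    intro b hb
    have h0 := sum_sum_jacobiSum_eq_zero_of_forall_ne X H hmul hinv hsep a b (hB b hb)
    rw [sum_sum_jacobiSum_eq_main_add X hone a b] at h0
    have e : S (b : ZMod p) = -E := by
      simp only [hS, hA, hE]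
      linear_combination h0
    rw [e, norm_neg]
  -- `#B ‖E‖² = Σ_{b∈B} ‖S b‖² ≤ Σ_{c ∈ 𝔽ₚ} ‖S c‖² = (p−1) Σ_{ψ∈X'} ‖A ψ‖²`
  have h1 : (B.card : ℝ) * ‖E‖ ^ 2 = ∑ b ∈ B, ‖S (b : ZMod p)‖ ^ 2 := by
    rw [Finset.sum_congr rfl fun b hb ↦ by rw [hbad b hb], Finset.sum_const, nsmul_eq_mul]
  have h2 : ∑ b ∈ B, ‖S (b : ZMod p)‖ ^ 2 ≤ ∑ c : ZMod p, ‖S c‖ ^ 2 := by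
    rw [show ∑ b ∈ B, ‖S (b : ZMod p)‖ ^ 2 = ∑ c ∈ B.map ⟨Units.val, Units.val_injective⟩, ‖S c‖ ^ 2 by
      rw [Finset.sum_map]; rfl]
    exact Finset.sum_le_sum_of_subset_of_nonneg (Finset.subset_univ _) fun _ _ _ ↦ sq_nonneg _
  have h3 : ∑ c : ZMod p, ‖S c‖ ^ 2 = ((p : ℝ) - 1) * ∑ ψ ∈ X', ‖A ψ‖ ^ 2 :=
    sum_norm_sq_sum_mul_apply_inv X' A
  have h4 : ∑ ψ ∈ X', ‖A ψ‖ ^ 2 ≤ ((X.card - 1 : ℕ) : ℝ) * (2 + ((X.card - 2 : ℕ) : ℝ) * Real.sqrt p) ^ 2 := by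
    have hle : ∀ ψ ∈ X', ‖A ψ‖ ^ 2 ≤ (2 + ((X.card - 2 : ℕ) : ℝ) * Real.sqrt p) ^ 2 := by
      intro ψ hψ
      have hψ1 : ψ ≠ 1 := Finset.ne_of_mem_erase hψ
      have hψX : ψ ∈ X := Finset.mem_of_mem_erase hψ
      exact pow_le_pow_left₀ (norm_nonneg _) (norm_rowSum_le X hone hinv a hψX hψ1) 2
    refine (Finset.sum_le_sum hle).trans ?_
    rw [Finset.sum_const, nsmul_eq_mul, hcard']
  have hp1 : (0 : ℝ) ≤ (p : ℝ) - 1 := by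
    have : (1 : ℝ) ≤ p := by exact_mod_cast (Fact.out : p.Prime).one_lt.le
    linarith
  -- `(p − 1 − n)² ≤ ‖E‖²`
  have h5 : ((p : ℝ) - 1 - X.card) ^ 2 ≤ ‖E‖ ^ 2 := by
    have hnn : (0 : ℝ) ≤ (p : ℝ) - 1 - X.card := by
      have : ((X.card + 1 : ℕ) : ℝ) ≤ p := by exact_mod_cast hn
      push_cast at this; linarith
    exact pow_le_pow_left₀ hnn (le_norm_mainRow X hone a) 2
  calc (B.card : ℝ) * ((p : ℝ) - 1 - X.card) ^ 2 ≤ (B.card : ℝ) * ‖E‖ ^ 2 :=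
        mul_le_mul_of_nonneg_left h5 (Nat.cast_nonneg _)
    _ = ∑ b ∈ B, ‖S (b : ZMod p)‖ ^ 2 := h1
    _ ≤ ∑ c : ZMod p, ‖S c‖ ^ 2 := h2
    _ = ((p : ℝ) - 1) * ∑ ψ ∈ X', ‖A ψ‖ ^ 2 := h3
    _ ≤ ((p : ℝ) - 1) * (((X.card - 1 : ℕ) : ℝ) * (2 + ((X.card - 2 : ℕ) : ℝ) * Real.sqrt p) ^ 2) :=
        mul_le_mul_of_nonneg_left h4 hp1

/-! ## §4. A good pivot exists when `3(n−1)(2+(n−2)√p)² < (p−1−n)²` -/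

/-- **Good pivot.** Under `n + 1 ≤ p` and `3(n−1)(2 + (n−2)√p)² < (p − 1 − n)²` (`n = #X`): for all units `a, x` there is a unit `b`
such that each of the pairs `(a, ab)`, `(ab, ax)`, `(b, x)` is realised by some `h₁, h₂ ∈ H` (`s h₁ + c h₂ = 1`). [folklore] -/
theorem exists_good_pivot (X : Finset (MulChar (ZMod p) ℂ)) (H : Subgroup (ZMod p)ˣ) (hone : 1 ∈ X)
    (hmul : ∀ χ ∈ X, ∀ ψ ∈ X, χ * ψ ∈ X) (hinv : ∀ χ ∈ X, χ⁻¹ ∈ X)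
    (hsep : ∀ m : (ZMod p)ˣ, m ∉ H → ∃ χ ∈ X, χ (m : ZMod p) ≠ 1) (hn : X.card + 1 ≤ p)
    (hineq : 3 * (((X.card - 1 : ℕ) : ℝ) * (2 + ((X.card - 2 : ℕ) : ℝ) * Real.sqrt p) ^ 2) < ((p : ℝ) - 1 - X.card) ^ 2)
    (a x : (ZMod p)ˣ) :
    ∃ b : (ZMod p)ˣ,
      (∃ h₁ ∈ H, ∃ h₂ ∈ H, ((a * h₁ : (ZMod p)ˣ) : ZMod p) + ((a * b * h₂ : (ZMod p)ˣ) : ZMod p) = 1) ∧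
      (∃ h₁ ∈ H, ∃ h₂ ∈ H, ((a * b * h₁ : (ZMod p)ˣ) : ZMod p) + ((a * x * h₂ : (ZMod p)ˣ) : ZMod p) = 1) ∧
      (∃ h₁ ∈ H, ∃ h₂ ∈ H, ((b * h₁ : (ZMod p)ˣ) : ZMod p) + ((x * h₂ : (ZMod p)ˣ) : ZMod p) = 1) := by
  classical
  by_contra hcon
  -- the three spoiler sets
  set B₁ : Finset (ZMod p)ˣ := Finset.univ.filter fun b ↦
    ∀ h₁ ∈ H, ∀ h₂ ∈ H, ((a * h₁ : (ZMod p)ˣ) : ZMod p) + ((a * b * h₂ : (ZMod p)ˣ) : ZMod p) ≠ 1 with hB₁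
  set B₂ : Finset (ZMod p)ˣ := Finset.univ.filter fun b ↦
    ∀ h₁ ∈ H, ∀ h₂ ∈ H, ((a * b * h₁ : (ZMod p)ˣ) : ZMod p) + ((a * x * h₂ : (ZMod p)ˣ) : ZMod p) ≠ 1 with hB₂
  set B₃ : Finset (ZMod p)ˣ := Finset.univ.filter fun b ↦
    ∀ h₁ ∈ H, ∀ h₂ ∈ H, ((b * h₁ : (ZMod p)ˣ) : ZMod p) + ((x * h₂ : (ZMod p)ˣ) : ZMod p) ≠ 1 with hB₃
  have hcover : (Finset.univ : Finset (ZMod p)ˣ) ⊆ B₁ ∪ B₂ ∪ B₃ := by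
    intro b _
    rw [Finset.mem_union, Finset.mem_union]
    by_cases g1 : ∃ h₁ ∈ H, ∃ h₂ ∈ H, ((a * h₁ : (ZMod p)ˣ) : ZMod p) + ((a * b * h₂ : (ZMod p)ˣ) : ZMod p) = 1
    · by_cases g2 : ∃ h₁ ∈ H, ∃ h₂ ∈ H, ((a * b * h₁ : (ZMod p)ˣ) : ZMod p) + ((a * x * h₂ : (ZMod p)ˣ) : ZMod p) = 1
      · by_cases g3 : ∃ h₁ ∈ H, ∃ h₂ ∈ H, ((b * h₁ : (ZMod p)ˣ) : ZMod p) + ((x * h₂ : (ZMod p)ˣ) : ZMod p) = 1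
        · exact absurd ⟨b, g1, g2, g3⟩ hcon
        · right
          refine Finset.mem_filter.mpr ⟨Finset.mem_univ _, ?_⟩
          push Not at g3
          exact g3
      · left; right
        refine Finset.mem_filter.mpr ⟨Finset.mem_univ _, ?_⟩
        push Not at g2
        exact g2
    · left; left
      refine Finset.mem_filter.mpr ⟨Finset.mem_univ _, ?_⟩
      push Not at g1
      exact g1
  set M : ℝ := ((p : ℝ) - 1) * (((X.card - 1 : ℕ) : ℝ) * (2 + ((X.card - 2 : ℕ) : ℝ) * Real.sqrt p) ^ 2) with hM
  set D : ℝ := ((p : ℝ) - 1 - X.card) ^ 2 with hD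
  -- each spoiler set is a «bad row» after a translation
  have c1 : (B₁.card : ℝ) * D ≤ M := by
    have hinj : Function.Injective fun b : (ZMod p)ˣ ↦ a * b := mul_right_injective a
    rw [← Finset.card_image_of_injective B₁ hinj]
    refine card_bad_mul_le X H hone hmul hinv hsep hn a _ ?_
    intro c hc
    obtain ⟨b, hb, rfl⟩ := Finset.mem_image.mp hc
    exact (Finset.mem_filter.mp hb).2
  have c2 : (B₂.card : ℝ) * D ≤ M := by
    have hinj : Function.Injective fun b : (ZMod p)ˣ ↦ a * b := mul_right_injective a
    rw [← Finset.card_image_of_injective B₂ hinj]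
    refine card_bad_mul_le X H hone hmul hinv hsep hn (a * x) _ ?_
    intro c hc h₁ hh₁ h₂ hh₂
    obtain ⟨b, hb, rfl⟩ := Finset.mem_image.mp hc
    have h := (Finset.mem_filter.mp hb).2 h₂ hh₂ h₁ hh₁
    rwa [add_comm] at h
  have c3 : (B₃.card : ℝ) * D ≤ M := by
    refine card_bad_mul_le X H hone hmul hinv hsep hn x _ ?_
    intro b hb h₁ hh₁ h₂ hh₂
    have h := (Finset.mem_filter.mp hb).2 h₂ hh₂ h₁ hh₁
    rwa [add_comm] at h
  -- count
  have hcard : ((p : ℝ) - 1) ≤ (B₁.card : ℝ) + B₂.card + B₃.card := by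
    have h := (Finset.card_le_card hcover).trans
      ((Finset.card_union_le _ _).trans (Nat.add_le_add_right (Finset.card_union_le _ _) _))
    rw [Finset.card_univ, ← Nat.card_eq_fintype_card] at h
    have hu : Nat.card (ZMod p)ˣ = p - 1 := by rw [Nat.card_eq_fintype_card, ZMod.card_units]
    rw [hu] at h
    have h' : ((p - 1 : ℕ) : ℝ) ≤ ((B₁.card + B₂.card + B₃.card : ℕ) : ℝ) := by exact_mod_cast h
    rw [Nat.cast_sub (Fact.out : p.Prime).one_lt.le] at h'
    push_cast at h'
    exact h'
  have hDnn : 0 ≤ D := sq_nonneg _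
  have hsum : ((p : ℝ) - 1) * D ≤ 3 * M := by
    calc ((p : ℝ) - 1) * D ≤ ((B₁.card : ℝ) + B₂.card + B₃.card) * D := mul_le_mul_of_nonneg_right hcard hDnn
      _ = (B₁.card : ℝ) * D + (B₂.card : ℝ) * D + (B₃.card : ℝ) * D := by ring
      _ ≤ M + M + M := add_le_add (add_le_add c1 c2) c3
      _ = 3 * M := by ring
  -- contradiction with the hypothesis: `3 M = (p−1) · 3(n−1)(…)² < (p−1) D`
  have hp1 : (0 : ℝ) < (p : ℝ) - 1 := by
    have : (2 : ℝ) ≤ p := by exact_mod_cast (Fact.out : p.Prime).two_le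
    linarith
  have : 3 * M < ((p : ℝ) - 1) * D := by
    rw [hM, hD]
    have := mul_lt_mul_of_pos_left hineq hp1
    linarith
  linarith

end Summit.BirchSwinnertonDyer.BirchSwinnertonDyer.Theorems.SignedMuAtTwo.CharacterSums
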